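import Summits.ValiantsHypothesis.ValiantsHypothesis.Theorems.TwoAdicLadderTwoIntegralNormalisationScaledHalfElim
import Summits.ValiantsHypothesis.ValiantsHypothesis.Theorems.TwoAdicLadderTwoIntegralNormalisationClearingBound

/-!
# TwoAdicLadder — crux `TwoIntegralNormalisation` (stmt-ValiantsHypothesis-5947), line `birth`,
# stub `stub_halfElim`: `ScaledHalfElimPoly` ⟸ circuits with constants of polynomial `2`-adic height

Route `ValiantsHypothesis/TwoAdicLadder`, crux `TwoIntegralNormalisation`, registered line
`Cruxes/TwoIntegralNormalisation/Lines/birth.lean`, open stub `stub_halfElim`. The census of this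
seat split the stub as `stub_halfElim ⟸ ScaledHalfElimPoly ∧ PolyDivision`
(`halfElim_of_scaledPoly_of_polyDivision`, file `…HalfElimKernel.lean`). This file discharges the
first hypothesis down to a statement about CONSTANTS only:

* `exists_complexity_two_pow_mul_perPoly_le_of_consts` — for a number field `K`, a prime `𝔭 ∋ 2`,
  and a `K`-circuit `Q` for `per_n` with exactly two operands per gate whose every constant /
  weight `c` is `𝔭`-integral after multiplication by `2^b`, `b ≤ B` (witnessed as
  `2^b · c · y = x`, `x, y ∈ 𝓞 K`, `y ∉ 𝔭`): `L_{𝓞_(𝔭)}(2^M · per_n) ≤ Q.size` with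
  `M ≤ B · Q.formalDegree · (Q.size + 1)` (quantitative clearing, `clearExpMax_le`).
* `scaledHalfElimPoly_of_polyHeightCircuits` — hence `ScaledHalfElimPoly` (with exponent `3e + 1`)
  follows from `PolyHeightCircuits` (exponent `e`): "whenever `L_K(per_n) ≤ s`, some number field
  `K'`, prime `𝔭 ∋ 2` and circuit of size and formal degree `≤ (s+n+2)^e` for `per_n` over `K'` has
  all its constants of `2`-adic valuation deficit `≤ (s+n+2)^e` at `𝔭`". Formal degree `≤ n` alone
  is free up to the factor `n²` (tree `ArithCircuit.exists_computes_formalDegree_le`); the content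
  of `PolyHeightCircuits` is the height of the constants.

So, kernel-checked: `stub_halfElim ⟸ PolyHeightCircuits ∧ PolyDivision`, both hypotheses being
statements the literature does not decide. Honest framing: `stub_halfElim`, the crux and
VP ≠ VNP are NOT proved here.
-/

noncomputable section

open MvPolynomial

-- the summit and the problem share the name `ValiantsHypothesis` (D-0017 single-conjunct layout)
set_option linter.dupNamespace false

namespace Summit.ValiantsHypothesis.ValiantsHypothesis.Theorems.TwoAdicLadder.TwoIntegralNormalisation

open NumberField Literature.Computability.AlgebraicComplexity

/-- The canonical map `𝓞_(𝔭) → K` over `𝓞 K`: injective, compatible with `𝓞 K → K`, and — for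
`𝔭 ∋ 2` — reaching every element of `K` after multiplication by a power of `2`
(cf. `exists_ringHom_localizationAtPrime_two`, which forgets the compatibility). [folklore] -/
theorem exists_ringHom_localizationAtPrime_two' (K : Type) [Field K] [NumberField K]
    (P : Ideal (𝓞 K)) [P.IsPrime] (h2 : (2 : 𝓞 K) ∈ P) :
    ∃ ι : Localization.AtPrime P →+* K, Function.Injective ι ∧
      (∀ a : 𝓞 K, ι (algebraMap (𝓞 K) (Localization.AtPrime P) a) = algebraMap (𝓞 K) K a) ∧
      ∀ c : K, ∃ (n : ℕ) (s : Localization.AtPrime P), ι s = ι 2 ^ n * c := by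
  classical
  have hunit : ∀ s : P.primeCompl, IsUnit (algebraMap (𝓞 K) K s) := fun s => by
    rw [isUnit_iff_ne_zero]
    intro h0
    apply s.2
    have : (s : 𝓞 K) = 0 := (IsFractionRing.injective (𝓞 K) K) (h0.trans (map_zero _).symm)
    rw [this]
    exact P.zero_mem
  letI : Algebra (Localization.AtPrime P) K :=
    (IsLocalization.lift (M := P.primeCompl) hunit).toAlgebra
  haveI : IsScalarTower (𝓞 K) (Localization.AtPrime P) K :=
    IsScalarTower.of_algebraMap_eq fun a => (IsLocalization.lift_eq hunit a).symm
  haveI : IsFractionRing (Localization.AtPrime P) K :=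
    IsFractionRing.isFractionRing_of_isDomain_of_isLocalization P.primeCompl
      (Localization.AtPrime P) K
  have hAK : ∀ a : 𝓞 K,
      algebraMap (Localization.AtPrime P) K (algebraMap (𝓞 K) (Localization.AtPrime P) a) =
        algebraMap (𝓞 K) K a :=
    fun a => (IsScalarTower.algebraMap_apply (𝓞 K) (Localization.AtPrime P) K a).symm
  -- the denominator property is the one of `exists_ringHom_localizationAtPrime_two` for THIS map:
  -- we re-derive it from the compatibility (every `c = x / y`, `N(y) = 2^n q`, `q ∉ 𝔭`).
  refine ⟨algebraMap (Localization.AtPrime P) K, IsFractionRing.injective _ _, hAK, fun c => ?_⟩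
  obtain ⟨x, y, hy, rfl⟩ := IsFractionRing.div_surjective (A := 𝓞 K) c
  have hy0 : y ≠ 0 := nonZeroDivisors.ne_zero hy
  set d : ℕ := Ideal.absNorm (Ideal.span ({y} : Set (𝓞 K))) with hd
  have hd0 : d ≠ 0 := by
    rw [hd, Ne, Ideal.absNorm_eq_zero_iff, Ideal.span_singleton_eq_bot]
    exact hy0
  have hdmem : (d : 𝓞 K) ∈ Ideal.span ({y} : Set (𝓞 K)) := Ideal.absNorm_mem _
  obtain ⟨y', hy'⟩ := Ideal.mem_span_singleton'.1 hdmem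
  obtain ⟨n, q, hq, hdq⟩ := Nat.exists_eq_two_pow_mul_odd hd0
  have hqP : (q : 𝓞 K) ∉ P := by
    intro hqP
    obtain ⟨r, hr⟩ := hq
    have h1 : (1 : 𝓞 K) = (q : 𝓞 K) - 2 * (r : 𝓞 K) := by
      rw [hr]; push_cast; ring
    have hmem : (1 : 𝓞 K) ∈ P := by
      rw [h1]
      exact P.sub_mem hqP (P.mul_mem_right _ h2)
    exact (Ideal.IsPrime.ne_top inferInstance) ((Ideal.eq_top_iff_one P).2 hmem)
  have hqP' : (q : 𝓞 K) ∈ P.primeCompl := hqP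
  set s : Localization.AtPrime P :=
    IsLocalization.mk' (Localization.AtPrime P) (x * y') ⟨(q : 𝓞 K), hqP'⟩ with hs
  refine ⟨n, s, ?_⟩
  have hspec := IsLocalization.mk'_spec (Localization.AtPrime P) (x * y') ⟨(q : 𝓞 K), hqP'⟩
  have key : algebraMap (Localization.AtPrime P) K s * (q : K) =
      algebraMap (𝓞 K) K x * algebraMap (𝓞 K) K y' := by
    have := congrArg (algebraMap (Localization.AtPrime P) K) hspec
    rw [map_mul, map_mul, map_mul, hAK, hAK, hAK] at this
    simpa [hs] using this
  have hqK : (q : K) ≠ 0 := by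
    have hq0 : q ≠ 0 := by rintro rfl; exact (Nat.not_odd_zero hq).elim
    exact_mod_cast hq0
  have hyK : algebraMap (𝓞 K) K y ≠ 0 := fun h =>
    hy0 ((IsFractionRing.injective (𝓞 K) K) (h.trans (map_zero _).symm))
  have hdK : algebraMap (𝓞 K) K y' * algebraMap (𝓞 K) K y = (2 : K) ^ n * (q : K) := by
    rw [← map_mul, hy', map_natCast, hdq]
    push_cast
    ring
  rw [map_ofNat]
  rw [show algebraMap (Localization.AtPrime P) K s =
      algebraMap (𝓞 K) K x * algebraMap (𝓞 K) K y' / (q : K) by rw [eq_div_iff hqK, key]]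
  rw [div_eq_iff hqK, mul_div_assoc', div_mul_eq_mul_div, eq_div_iff hyK]
  linear_combination (algebraMap (𝓞 K) K x) * hdK

/-- **Quantitative scaled `1/2`-elimination for a given circuit.** For a number field `K`, a prime
`𝔭 ∋ 2` of `𝓞 K` and a `K`-circuit `Q` computing `per_n` with exactly two operands per gate, all
of whose constants / weights `c` satisfy `2^b · c · y = x` for some `b ≤ B`, `x, y ∈ 𝓞 K`, `y ∉ 𝔭`
(`2`-adic valuation deficit `≤ B` at `𝔭`): `L_{𝓞_(𝔭)}(2^M · per_n) ≤ Q.size` for some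
`M ≤ B · Q.formalDegree · (Q.size + 1)`. [folklore] -/
theorem exists_complexity_two_pow_mul_perPoly_le_of_consts (n B : ℕ) (K : Type) [Field K]
    [NumberField K] (P : Ideal (𝓞 K)) [P.IsPrime] (h2 : (2 : 𝓞 K) ∈ P)
    (Q : ArithCircuit K (Fin n × Fin n)) (hfan : ∀ g ∈ Q.gates, g.fanIn = 2)
    (hQ : Q.Computes (perPoly (Fin n) K))
    (hB : ∀ c ∈ Q.consts, ∃ b ≤ B, ∃ x y : 𝓞 K, y ∉ P ∧ (2 : K) ^ b * c * algebraMap (𝓞 K) K y =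
      algebraMap (𝓞 K) K x) :
    ∃ M : ℕ, M ≤ B * Q.formalDegree * (Q.size + 1) ∧
      complexity (C ((2 : Localization.AtPrime P) ^ M) *
        perPoly (Fin n) (Localization.AtPrime P)) ≤ Q.size := by
  classical
  obtain ⟨ι, hι, hcompat, hden⟩ := exists_ringHom_localizationAtPrime_two' K P h2
  -- minimal exponents and numerators
  let N : K → ℕ := fun c => Nat.find (hden c)
  have hNspec : ∀ c, ∃ s : Localization.AtPrime P, ι s = ι 2 ^ N c * c :=
    fun c => Nat.find_spec (hden c)
  choose num hnum using hNspec
  -- the deficit bound transfers to `N`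
  have hNB : ∀ c ∈ Q.consts, N c ≤ B := by
    intro c hc
    obtain ⟨b, hb, x, y, hyP, hxy⟩ := hB c hc
    refine (Nat.find_min' (hden c) ?_).trans hb
    have hyP' : y ∈ P.primeCompl := hyP
    refine ⟨IsLocalization.mk' (Localization.AtPrime P) x ⟨y, hyP'⟩, ?_⟩
    have hspec := IsLocalization.mk'_spec (Localization.AtPrime P) x ⟨y, hyP'⟩
    have key := congrArg ι hspec
    rw [map_mul, hcompat, hcompat] at key
    have hyK : algebraMap (𝓞 K) K y ≠ 0 := by
      intro h0
      apply hyP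
      have : y = 0 := (IsFractionRing.injective (𝓞 K) K) (h0.trans (map_zero _).symm)
      rw [this]; exact P.zero_mem
    rw [map_ofNat]
    -- `ι (mk' x y) = x / y = 2^b c`
    have h1 : ι (IsLocalization.mk' (Localization.AtPrime P) x ⟨y, hyP'⟩) =
        algebraMap (𝓞 K) K x / algebraMap (𝓞 K) K y := by
      rw [eq_div_iff hyK]
      simpa using key
    rw [h1, div_eq_iff hyK, hxy]
  obtain ⟨M, hM, hle⟩ := exists_complexity_C_pow_mul_le_of_consts ι hι num N 2 hnum
    (perPoly (Fin n) (Localization.AtPrime P)) Q hfan (by rwa [map_perPoly]) hNB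
  exact ⟨M, hM, hle⟩

/-- Exponent bookkeeping: `B · F · (S + 1) ≤ T^(3e+1)` when `B, F, S ≤ T^e` and `T ≥ 2`. [folklore] -/
theorem polyHeight_envelope {B F S T e : ℕ} (hT : 2 ≤ T) (hB : B ≤ T ^ e) (hF : F ≤ T ^ e)
    (hS : S ≤ T ^ e) : B * F * (S + 1) ≤ T ^ (3 * e + 1) := by
  have h1 : S + 1 ≤ T ^ e * T := by
    have : 1 ≤ T ^ e := Nat.one_le_pow _ _ (by omega)
    nlinarith
  calc B * F * (S + 1) ≤ T ^ e * T ^ e * (T ^ e * T) :=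
        Nat.mul_le_mul (Nat.mul_le_mul hB hF) h1
    _ = T ^ (3 * e + 1) := by ring

/-- **`ScaledHalfElimPoly` follows from `PolyHeightCircuits`.** If (hypothesis, exponent `e`)
every bound `L_K(per_n) ≤ s` over a number field is witnessed over some number field `K'` by a
circuit with exactly two operands per gate, of size and formal degree `≤ (s+n+2)^e`, whose
constants all have `2`-adic valuation deficit `≤ (s+n+2)^e` at some prime `𝔭 ∋ 2`, then the
clearing exponent is polynomial: `L_{𝓞_(𝔭)}(2^M · per_n) ≤ (s+n+2)^(3e+1)` with
`M ≤ (s+n+2)^(3e+1)` — the hypothesis `hS` of `halfElim_of_scaledPoly_of_polyDivision`.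
[folklore] -/
theorem scaledHalfElimPoly_of_polyHeightCircuits
    (h : ∃ e : ℕ, ∀ (n s : ℕ) (K : Type) [Field K] [NumberField K],
      complexity (perPoly (Fin n) K) ≤ s →
        ∃ (K' : Type) (_ : Field K') (_ : NumberField K') (P : Ideal (𝓞 K')) (_ : P.IsPrime)
          (Q : ArithCircuit K' (Fin n × Fin n)),
          (2 : 𝓞 K') ∈ P ∧ (∀ g ∈ Q.gates, g.fanIn = 2) ∧ Q.Computes (perPoly (Fin n) K') ∧
          Q.size ≤ (s + n + 2) ^ e ∧ Q.formalDegree ≤ (s + n + 2) ^ e ∧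
          ∀ c ∈ Q.consts, ∃ b ≤ (s + n + 2) ^ e, ∃ x y : 𝓞 K', y ∉ P ∧
            (2 : K') ^ b * c * algebraMap (𝓞 K') K' y = algebraMap (𝓞 K') K' x) :
    ∃ e : ℕ, ∀ (n s : ℕ) (K : Type) [Field K] [NumberField K],
      complexity (perPoly (Fin n) K) ≤ s →
        ∃ (K' : Type) (_ : Field K') (_ : NumberField K')
          (P : Ideal (𝓞 K')) (_ : P.IsPrime), (2 : 𝓞 K') ∈ P ∧ ∃ M : ℕ, M ≤ (s + n + 2) ^ e ∧
          complexity (C ((2 : Localization.AtPrime P) ^ M) *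
            perPoly (Fin n) (Localization.AtPrime P)) ≤ (s + n + 2) ^ e := by
  obtain ⟨e, he⟩ := h
  refine ⟨3 * e + 1, fun n s K hFK hNK hs => ?_⟩
  obtain ⟨K', hF, hNF, P, hP, Q, h2, hfan, hQ, hsize, hdeg, hconsts⟩ := @he n s K hFK hNK hs
  obtain ⟨M, hM, hle⟩ :=
    exists_complexity_two_pow_mul_perPoly_le_of_consts n ((s + n + 2) ^ e) K' P h2 Q hfan hQ hconsts
  have hT : 2 ≤ s + n + 2 := by omega
  refine ⟨K', hF, hNF, P, hP, h2, M, hM.trans (polyHeight_envelope hT le_rfl hdeg hsize), ?_⟩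
  refine hle.trans (hsize.trans ?_)
  exact Nat.pow_le_pow_right (by omega) (by omega)

end Summit.ValiantsHypothesis.ValiantsHypothesis.Theorems.TwoAdicLadder.TwoIntegralNormalisation

end
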